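import Literature.IUT.HodgeTheaters.PuncturedEllipticArrowModel
import HarnessLib

/-!
# The finite model of [IUTchI] §1, part 2: the `Δ_ε⁺`-coordinate `ℓ`, the subgroups `K ⊆ K′`, the decomposition groups `D_i`

Mochizuki, *Inter-universal Teichmüller theory I*, kurims manuscript (May 2020), §1 pp. 37–38
([IUTchI] §1 p.37) [claim: Mochizuki2012, status: disputed] (D-0012 claim key; series status DISPUTED —
WITNESS-class module, pure finite group theory over `PuncturedEllipticArrowModel.lean`; nothing of the
series is asserted, no side is taken on [IUTchIII] Cor. 3.12).

Continues the model `Π_C := N ⋊ D_l`, `N = (ℤ/l)·A ⊕ ⨁_i (ℤ/l)·B_i` (abc-iut-L5-t1; see part 1 for the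
dictionary with the printed objects): here the `Δ_ε⁺`-COORDINATE `ℓ(A, f) := f(0) − f(1)` (in the model,
`Δ_X̲ ↠ Δ_ε⁺ ≅ ℤ/l` of p. 38 is `ℓ`; it is invariant under the involution `σ_0 = ι̲`, p. 38 "the natural
action … commutes with the action of `ι`"), the subgroups `K := N ∩ Ker ℓ` (the future `Π_{X̲→} = jKer`) and
`K′ := K ⋊ ⟨s⟩` (the future `Π_{C̲→} = galKer`), the decomposition groups `D_i := ⟨ĉ_i⟩` of the cusps with the
EXACT conjugation formula `g D_i g⁻¹ = D_{g·i}` (`conj_smul_Dm`), the ingredients `EpsSup` (`⨆ D_x`,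
`x ∉ {0, ±1}`), `commSet`, `powSet` of the §1 construction as they will read in the model, the lift
`ŝ = (0, s)` of `ι̲`, and the coordinate homomorphisms `ellN : N → ℤ/l`, `ellC : Π_C̲ → ℤ/l`,
`rotIdx : Π_X → ℤ/l` used for the index computations of the sequel.  No instance, no `sorry`, symbolic `l`.
-/

namespace Literature.IUT.HodgeTheaters

namespace PuncturedEllipticData

namespace ArrowModel

open DihedralGroup
open scoped Pointwise

variable (l : ℕ)


/-! ### The functional `ℓ(A, f) = f(0) − f(1)` (the `Δ_ε⁺`-coordinate) and `K, K′` -/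

/-- `ℓ(A, f) := f(0) − f(1)`: the coordinate of `N ↠ Δ_ε⁺ ≅ ℤ/l` in the model.
[claim: Mochizuki2012, status: disputed] -/
def ell : V l →+ ZMod l where
  toFun p := p.2 0 - p.2 1
  map_zero' := by simp
  map_add' p q := by simp only [Prod.snd_add, Pi.add_apply]; ring

/-- `ℓ` evaluated. [claim: Mochizuki2012, status: disputed] -/
@[simp] theorem ell_apply (p : V l) : ell l p = p.2 0 - p.2 1 := rfl

/-- `ℓ` is invariant under the reflections `σ_k` with `k = 0`… in fact under `σ_0`: `ℓ ∘ σ_0 = ℓ`.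
[claim: Mochizuki2012, status: disputed] -/
theorem ell_refl_zero (p : V l) : ell l (refl l 0 p) = ell l p := by
  simp only [ell_apply, refl_apply, sub_zero, sub_self]
  ring

/-- `ℓ ∘ φ_d = ℓ` for `d ∈ {1, s}`. [claim: Mochizuki2012, status: disputed] -/
theorem ell_dact_of_mem {d : DihedralGroup l} (hd : d = 1 ∨ d = sr 0) (p : V l) :
    ell l (dact l d p) = ell l p := by
  rcases hd with rfl | rfl
  · simp only [one_def, dact_r, rot_apply, ell_apply, sub_zero]
  · rw [dact_sr, ell_refl_zero]

/-- `K := {(A, f, 1) : f(0) = f(1)} = Ker(N ↠ Δ_ε⁺)` (will be `jKer = Π_{X̲→}` of the model).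
[claim: Mochizuki2012, status: disputed] -/
def Khat : Subgroup (G l) where
  carrier := {g | g.right = 1 ∧ ell l (Multiplicative.toAdd g.left) = 0}
  mul_mem' := by
    rintro g h ⟨hg1, hg2⟩ ⟨hh1, hh2⟩
    refine ⟨by rw [SemidirectProduct.mul_right, hg1, hh1, mul_one], ?_⟩
    rw [SemidirectProduct.mul_left, hg1, map_one, MulAut.one_apply, toAdd_mul, map_add, hg2, hh2,
      add_zero]
  one_mem' := ⟨rfl, by simp⟩
  inv_mem' := by
    rintro g ⟨hg1, hg2⟩
    refine ⟨by rw [SemidirectProduct.inv_right, hg1, inv_one], ?_⟩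
    rw [SemidirectProduct.inv_left, hg1, inv_one, map_one, MulAut.one_apply, toAdd_inv, map_neg, hg2,
      neg_zero]

/-- `K′ := K ⋊ ⟨s⟩ = {(n, d) : d ∈ {1, s}, ℓ(n) = 0}` (will be `galKer = Π_{C̲→}` of the model).
[claim: Mochizuki2012, status: disputed] -/
def Khat' : Subgroup (G l) where
  carrier := {g | (g.right = 1 ∨ g.right = sr 0) ∧ ell l (Multiplicative.toAdd g.left) = 0}
  mul_mem' := by
    rintro g h ⟨hg1, hg2⟩ ⟨hh1, hh2⟩
    refine ⟨(PiCbarm l).mul_mem hg1 hh1, ?_⟩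
    rw [SemidirectProduct.mul_left, toAdd_mul, map_add, hg2, zero_add, toAdd_phi_apply,
      ell_dact_of_mem l hg1, hh2]
  one_mem' := ⟨Or.inl rfl, by simp⟩
  inv_mem' := by
    rintro g ⟨hg1, hg2⟩
    refine ⟨(PiCbarm l).inv_mem hg1, ?_⟩
    have hinv : g.right⁻¹ = 1 ∨ g.right⁻¹ = sr 0 := by
      rcases hg1 with h | h
      · exact Or.inl (by rw [h, inv_one])
      · exact Or.inr (by rw [h, inv_sr])
    rw [SemidirectProduct.inv_left, toAdd_phi_apply, ell_dact_of_mem l hinv, toAdd_inv, map_neg, hg2,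
      neg_zero]

/-- Membership in `K`. [claim: Mochizuki2012, status: disputed] -/
theorem mem_Khat_iff (g : G l) : g ∈ Khat l ↔ g.right = 1 ∧ ell l (Multiplicative.toAdd g.left) = 0 :=
  Iff.rfl

/-- Membership in `K′`. [claim: Mochizuki2012, status: disputed] -/
theorem mem_Khat'_iff (g : G l) :
    g ∈ Khat' l ↔ (g.right = 1 ∨ g.right = sr 0) ∧ ell l (Multiplicative.toAdd g.left) = 0 := Iff.rfl

/-- `inN v ∈ K ↔ ℓ v = 0`. [claim: Mochizuki2012, status: disputed] -/
theorem inN_mem_Khat_iff (v : V l) : inN l v ∈ Khat l ↔ ell l v = 0 := by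
  rw [mem_Khat_iff, inN_right, inN_left, toAdd_ofAdd]; exact and_iff_right rfl

/-- `K ≤ N`. [claim: Mochizuki2012, status: disputed] -/
theorem Khat_le_Nhat : Khat l ≤ Nhat l := fun g hg => (mem_Nhat_iff l g).mpr hg.1

/-- `K ≤ K′`. [claim: Mochizuki2012, status: disputed] -/
theorem Khat_le_Khat' : Khat l ≤ Khat' l := fun _ hg => ⟨Or.inl hg.1, hg.2⟩

/-- `K′ ≤ Π_C̲`. [claim: Mochizuki2012, status: disputed] -/
theorem Khat'_le_PiCbarm : Khat' l ≤ PiCbarm l := fun _ hg => hg.1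

/-- `N ∩ K′ = K`. [claim: Mochizuki2012, status: disputed] -/
theorem Nhat_inf_Khat' : Nhat l ⊓ Khat' l = Khat l := by
  ext g
  rw [Subgroup.mem_inf, mem_Nhat_iff, mem_Khat'_iff, mem_Khat_iff]
  constructor
  · rintro ⟨h1, -, h2⟩; exact ⟨h1, h2⟩
  · rintro ⟨h1, h2⟩; exact ⟨h1, Or.inl h1, h2⟩

/-! ### Decomposition groups `D_i := ⟨(c_i, 1)⟩` and conjugation inside `N ⋊ D_l` -/

/-- The inertia element `ĉ_i := (c_i, 1) ∈ N ⊆ Π_C` of the cusp `i`. [claim: Mochizuki2012, status: disputed] -/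
def chat (i : ZMod l) : G l := inN l (cvec l i)

/-- The decomposition (= inertia, `G_k = 1`) group of the cusp `i`: `D_i := ⟨ĉ_i⟩`.
[claim: Mochizuki2012, status: disputed] -/
def Dm (i : ZMod l) : Subgroup (G l) := Subgroup.zpowers (chat l i)

/-- KEY CONJUGATION FORMULA: `g · (v, 1) · g⁻¹ = (φ_{g.right}(v), 1)` (`N` is abelian).
[claim: Mochizuki2012, status: disputed] -/
theorem conj_inN (g : G l) (v : V l) :
    g * inN l v * g⁻¹ = inN l (dact l g.right v) := by
  refine SemidirectProduct.ext ?_ ?_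
  · simp only [SemidirectProduct.mul_left, SemidirectProduct.mul_right, SemidirectProduct.inv_left,
      inN_left, inN_right, mul_one]
    rw [← MulAut.mul_apply, ← map_mul, mul_inv_cancel, map_one, MulAut.one_apply, mul_comm g.left,
      mul_assoc, mul_inv_cancel, mul_one, phi_ofAdd]
  · simp only [SemidirectProduct.mul_right, SemidirectProduct.inv_right, inN_right, mul_one,
      mul_inv_cancel]

/-- `g ĉ_i g⁻¹ = ĉ_{g·i}`. [claim: Mochizuki2012, status: disputed] -/
theorem conj_chat (g : G l) (i : ZMod l) :
    g * chat l i * g⁻¹ = chat l (cuspAct l g.right i) := by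
  unfold chat; rw [conj_inN, dact_cvec]

/-- `g D_i g⁻¹ = D_{g·i}` EXACTLY. [claim: Mochizuki2012, status: disputed] -/
theorem conj_smul_Dm (g : G l) (i : ZMod l) :
    MulAut.conj g • Dm l i = Dm l (cuspAct l g.right i) := by
  unfold Dm
  rw [Subgroup.pointwise_smul_def, MonoidHom.map_zpowers]
  simp only [MulDistribMulAction.toMonoidEnd_apply, MulDistribMulAction.toMonoidHom_apply,
    MulAut.smul_def, MulAut.conj_apply, conj_chat]

/-- `D_i ≤ N`. [claim: Mochizuki2012, status: disputed] -/
theorem Dm_le_Nhat (i : ZMod l) : Dm l i ≤ Nhat l := by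
  unfold Dm
  rw [Subgroup.zpowers_le]
  exact inN_mem_Nhat l _

/-- `ℓ(c_i) = [i = −1] + [i = 1] − 2[i = 0]`… concretely: `ℓ(c_i) = 0` for `i ∉ {0, 1, −1}`.
[claim: Mochizuki2012, status: disputed] -/
theorem ell_cvec_eq_zero {i : ZMod l} (h0 : i ≠ 0) (h1 : i ≠ 1) (h2 : i ≠ -1) : ell l (cvec l i) = 0 := by
  simp only [ell_apply, cvec, Pi.sub_apply, δ_apply]
  have e1 : ¬ (0 : ZMod l) = i + 1 := fun h => h2 (by linear_combination -h)
  have e2 : ¬ (0 : ZMod l) = i := fun h => h0 h.symm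
  have e3 : ¬ (1 : ZMod l) = i + 1 := fun h => h0 (by linear_combination -h)
  have e4 : ¬ (1 : ZMod l) = i := fun h => h1 h.symm
  rw [if_neg e1, if_neg e2, if_neg e3, if_neg e4]; ring

/-- `D_i ≤ K` for every cusp `i ∉ {ε⁰, ε′, ε″} = {0, 1, −1}` (these inertia groups die in `Δ_ε`).
[claim: Mochizuki2012, status: disputed] -/
theorem Dm_le_Khat {i : ZMod l} (h0 : i ≠ 0) (h1 : i ≠ 1) (h2 : i ≠ -1) : Dm l i ≤ Khat l := by
  unfold Dm chat
  rw [Subgroup.zpowers_le, inN_mem_Khat_iff]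
  exact ell_cvec_eq_zero l h0 h1 h2

/-! ### The ingredients of the §1 construction in the model, and coordinate homomorphisms -/

/-- `⨆ D_x` over the nonzero cusps `x ≠ ε′, ε″`, i.e. `x ∉ {0, 1, −1}` (the inertia killed in `Δ_ε`).
[claim: Mochizuki2012, status: disputed] -/
def EpsSup : Subgroup (G l) := ⨆ x : {x : ZMod l // x ≠ 0 ∧ x ≠ 1 ∧ x ≠ -1}, Dm l x.1

/-- The commutators `x c x⁻¹ c⁻¹`, `x ∈ N = Δ_X̲`, `c ∈ Π_C̲ ∖ N` (the `(−1)`-eigenspace generators of p. 38).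
[claim: Mochizuki2012, status: disputed] -/
def commSet : Set (G l) := {z | ∃ x ∈ Nhat l, ∃ c ∈ PiCbarm l, c ∉ Nhat l ∧ z = x * c * x⁻¹ * c⁻¹}

/-- The `l`-th powers of the elements of `Π_C̲ = Δ_C̲` (p. 38: `Gal(X̲/C̲)` = the `l`-th powers in `ℤ/2l`).
[claim: Mochizuki2012, status: disputed] -/
def powSet : Set (G l) := (fun y : G l => y ^ l) '' (PiCbarm l : Set (G l))

/-- `ŝ := (0, s)`, a lift of the involution `ι̲`. [claim: Mochizuki2012, status: disputed] -/
def sigmaHat : G l := SemidirectProduct.inr (sr 0)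

/-- `ŝ.right = s`. [claim: Mochizuki2012, status: disputed] -/
@[simp] theorem sigmaHat_right : (sigmaHat l).right = sr 0 := rfl

/-- `ŝ.left = 1`. [claim: Mochizuki2012, status: disputed] -/
@[simp] theorem sigmaHat_left : (sigmaHat l).left = 1 := rfl

/-- `ŝ ∈ Π_C̲`. [claim: Mochizuki2012, status: disputed] -/
theorem sigmaHat_mem_PiCbarm : sigmaHat l ∈ PiCbarm l := Or.inr rfl

/-- `ŝ ∉ N`. [claim: Mochizuki2012, status: disputed] -/
theorem sigmaHat_not_mem_Nhat : sigmaHat l ∉ Nhat l := by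
  rw [mem_Nhat_iff, sigmaHat_right, one_def]
  intro h; cases h

/-- `ŝ ∉ Π_X`. [claim: Mochizuki2012, status: disputed] -/
theorem sigmaHat_not_mem_PiXm : sigmaHat l ∉ PiXm l := by
  rintro ⟨k, hk⟩
  rw [sigmaHat_right] at hk
  cases hk

/-- `ŝ² = 1`. [claim: Mochizuki2012, status: disputed] -/
theorem sigmaHat_mul_self : sigmaHat l * sigmaHat l = 1 := by
  unfold sigmaHat; rw [← map_mul, sr_mul_self, map_one]

/-- `ŝ⁻¹ = ŝ`. [claim: Mochizuki2012, status: disputed] -/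
theorem sigmaHat_inv : (sigmaHat l)⁻¹ = sigmaHat l :=
  inv_eq_of_mul_eq_one_right (sigmaHat_mul_self l)

/-- `(v, 1)·ŝ` has components `(ofAdd v, s)`. [claim: Mochizuki2012, status: disputed] -/
theorem inN_mul_sigmaHat_right (v : V l) : (inN l v * sigmaHat l).right = sr 0 := by
  rw [SemidirectProduct.mul_right, inN_right, sigmaHat_right, one_mul]

/-- `(v, 1)·ŝ` has `N`-component `v`. [claim: Mochizuki2012, status: disputed] -/
theorem inN_mul_sigmaHat_left (v : V l) : (inN l v * sigmaHat l).left = Multiplicative.ofAdd v := by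
  rw [SemidirectProduct.mul_left, inN_left, inN_right, map_one, MulAut.one_apply, sigmaHat_left, mul_one]

/-- Every element of `Π_C̲` is `(v, 1)` or `(v, 1)·ŝ`. [claim: Mochizuki2012, status: disputed] -/
theorem eq_of_mem_PiCbarm {g : G l} (hg : g ∈ PiCbarm l) :
    g = inN l (Multiplicative.toAdd g.left) ∨ g = inN l (Multiplicative.toAdd g.left) * sigmaHat l := by
  rcases hg with h | h
  · exact Or.inl (eq_inN_of_right_eq_one l h)
  · right
    refine SemidirectProduct.ext ?_ ?_
    · rw [inN_mul_sigmaHat_left]; rfl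
    · rw [inN_mul_sigmaHat_right, h]

/-- `inN` of a finite sum lies in a subgroup as soon as every summand does. [claim: Mochizuki2012, status: disputed] -/
theorem inN_sum_mem {ι : Type*} (S : Subgroup (G l)) (s : Finset ι) (f : ι → V l)
    (h : ∀ i ∈ s, inN l (f i) ∈ S) : inN l (∑ i ∈ s, f i) ∈ S := by
  refine Finset.sum_induction f (fun v => inN l v ∈ S) (fun a b ha hb => ?_) ?_ h
  · rw [inN_add]; exact S.mul_mem ha hb
  · rw [inN_zero]; exact S.one_mem

/-- `inN (n • v) = (inN v)^n`. [claim: Mochizuki2012, status: disputed] -/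
theorem inN_nsmul (n : ℕ) (v : V l) : inN l (n • v) = inN l v ^ n := by
  unfold inN; rw [ofAdd_nsmul, map_pow]

/-- `B_j`-coordinate vectors: `Pi.single j t = t.val • δ_j` (as an `ℕ`-multiple). [claim: Mochizuki2012, status: disputed] -/
theorem single_eq_nsmul_δ [NeZero l] (j t : ZMod l) : (Pi.single j t : ZMod l → ZMod l) = t.val • δ l j := by
  funext m
  rw [Pi.smul_apply, δ_apply, Pi.single_apply]
  split_ifs
  · rw [nsmul_eq_mul, mul_one, ZMod.natCast_zmod_val]
  · rw [smul_zero]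

/-- The `Δ_ε⁺`-coordinate on `N`: `(v, 1) ↦ ℓ(v)`. [claim: Mochizuki2012, status: disputed] -/
def ellN : Nhat l →* Multiplicative (ZMod l) where
  toFun g := Multiplicative.ofAdd (ell l (Multiplicative.toAdd g.1.left))
  map_one' := by simp
  map_mul' g h := by
    have hg : g.1.right = 1 := (mem_Nhat_iff l _).mp g.2
    rw [← ofAdd_add, Subgroup.coe_mul, SemidirectProduct.mul_left, hg, map_one, MulAut.one_apply,
      toAdd_mul, map_add]

/-- `ellN` evaluated. [claim: Mochizuki2012, status: disputed] -/
theorem ellN_apply (g : Nhat l) :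
    ellN l g = Multiplicative.ofAdd (ell l (Multiplicative.toAdd g.1.left)) := rfl

/-- The `Δ_ε⁺`-coordinate extended to `Π_C̲ = N ⋊ ⟨s⟩` (well defined since `ℓ ∘ σ_0 = ℓ`): `(v, d) ↦ ℓ(v)`.
[claim: Mochizuki2012, status: disputed] -/
def ellC : PiCbarm l →* Multiplicative (ZMod l) where
  toFun g := Multiplicative.ofAdd (ell l (Multiplicative.toAdd g.1.left))
  map_one' := by simp
  map_mul' g h := by
    rw [← ofAdd_add, Subgroup.coe_mul, SemidirectProduct.mul_left, toAdd_mul, map_add, toAdd_phi_apply,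
      ell_dact_of_mem l g.2]

/-- `ellC` evaluated. [claim: Mochizuki2012, status: disputed] -/
theorem ellC_apply (g : PiCbarm l) :
    ellC l g = Multiplicative.ofAdd (ell l (Multiplicative.toAdd g.1.left)) := rfl

/-- The rotation index of a dihedral element (`r_k ↦ k`, `s r_k ↦ k`). [claim: Mochizuki2012, status: disputed] -/
def rotIndex : DihedralGroup l → ZMod l
  | r k => k
  | sr k => k

/-- `rotIndex (r k) = k`. [claim: Mochizuki2012, status: disputed] -/
@[simp] theorem rotIndex_r (k : ZMod l) : rotIndex l (r k) = k := rfl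

/-- The degree coordinate on `Π_X = N ⋊ ⟨r⟩`: `(v, r_k) ↦ k` (its kernel is `N = Π_X̲`).
[claim: Mochizuki2012, status: disputed] -/
def rotIdx : PiXm l →* Multiplicative (ZMod l) where
  toFun g := Multiplicative.ofAdd (rotIndex l g.1.right)
  map_one' := by
    rw [Subgroup.coe_one, SemidirectProduct.one_right, one_def, rotIndex_r, ofAdd_zero]
  map_mul' g h := by
    obtain ⟨k, hk⟩ := g.2
    obtain ⟨k', hk'⟩ := h.2
    rw [← ofAdd_add, Subgroup.coe_mul, SemidirectProduct.mul_right, hk, hk', r_mul_r, rotIndex_r,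
      rotIndex_r, rotIndex_r]

/-- `rotIdx` evaluated. [claim: Mochizuki2012, status: disputed] -/
theorem rotIdx_apply (g : PiXm l) : rotIdx l g = Multiplicative.ofAdd (rotIndex l g.1.right) := rfl

/-- The sign of a dihedral element (`r_k ↦ 0`, `s r_k ↦ 1`). [claim: Mochizuki2012, status: disputed] -/
def sgnIndex : DihedralGroup l → ZMod 2
  | r _ => 0
  | sr _ => 1

/-- `sgnIndex (r k) = 0`. [claim: Mochizuki2012, status: disputed] -/
@[simp] theorem sgnIndex_r (k : ZMod l) : sgnIndex l (r k) = 0 := rfl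

/-- `sgnIndex (sr k) = 1`. [claim: Mochizuki2012, status: disputed] -/
@[simp] theorem sgnIndex_sr (k : ZMod l) : sgnIndex l (sr k) = 1 := rfl

/-- The sign homomorphism `D_l → ℤ/2` (kernel = the rotations). [claim: Mochizuki2012, status: disputed] -/
def sgnHom : DihedralGroup l →* Multiplicative (ZMod 2) where
  toFun d := Multiplicative.ofAdd (sgnIndex l d)
  map_one' := rfl
  map_mul' d e := by
    cases d <;> cases e <;>
      simp only [r_mul_r, r_mul_sr, sr_mul_r, sr_mul_sr, sgnIndex_r, sgnIndex_sr] <;> decide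

/-- `sgnHom` evaluated. [claim: Mochizuki2012, status: disputed] -/
theorem sgnHom_apply (d : DihedralGroup l) : sgnHom l d = Multiplicative.ofAdd (sgnIndex l d) := rfl

/-- The pair of coordinates `(sign, ℓ)` on `Π_C̲ = N ⋊ ⟨s⟩`: `(v, d) ↦ (sgn d, ℓ v)`; its kernel is `K` and it
identifies `Π_C̲/K` with `ℤ/2 × ℤ/l ≅ ℤ/2l` (p. 38 "`Gal(X̲→/C̲) ⥲ Gal(X̲/C̲) × Gal(C̲→/C̲) ≅ ℤ/2lℤ`").
[claim: Mochizuki2012, status: disputed] -/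
def psiC : PiCbarm l →* Multiplicative (ZMod 2) × Multiplicative (ZMod l) :=
  (((sgnHom l).comp SemidirectProduct.rightHom).comp (PiCbarm l).subtype).prod (ellC l)

/-- `psiC` evaluated. [claim: Mochizuki2012, status: disputed] -/
theorem psiC_apply (g : PiCbarm l) :
    psiC l g = (Multiplicative.ofAdd (sgnIndex l g.1.right),
      Multiplicative.ofAdd (ell l (Multiplicative.toAdd g.1.left))) := rfl

end ArrowModel

end PuncturedEllipticData

end Literature.IUT.HodgeTheaters
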